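import Summits.AtomisticToContinuum.FouriersLaw.Theorems.EmbeddedDrudeMourreDrudeDissolutionStubWickShellDynamicChaos
import HarnessLib

/-!
# Sup-norm bounds for thermal waves, Wick kernels and Wick vectors
(stub `stub_wickShellDynamic` (K6) of line `gram-pencil-harmonic-chaos`, crux `EmbeddedDrudeMourre.DrudeDissolution`,
item stmt-AtomisticToContinuum-12593; `--supports` file, closes nothing)

WHAT. The a-priori bounds feeding the iterated-Grönwall uniqueness argument of the harmonic spectral formula, with the
weight `B(f) = ⨆_k ‖w_f(k)‖` (sup norm of the thermal wave of `f`, finite by continuity on the compact circle):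
* `ciSup_norm_thermalWave_apply_le`: `B(L f) ≤ √(|ω₂|+4) B(f)` when `w_{Lf} = −iω w_f` (`ω ≤ √(|ω₂|+4)`);
* `sum_prod_ciSup_update_le`: `Σ_i Π_j B((f[i ← Lf_i])_j) ≤ N √(|ω₂|+4) Π_j B(f_j)` — the weights of the closed system
  grow at most linearly under the slot rule;
* `norm_wickKernel_le`: `‖Φ[f]_{m,n}(κ)‖ ≤ N! Π_i B(f_i)`;
* `norm_wickVector_le` (registered helper stub `wickVector_norm_le`): `‖ι[:f:]‖ ≤ #{sectors of degree N} · N! · Π_i B(f_i)`.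

HOW. Elementary estimates; `‖ι[:f:]‖² = Re ⟪ι[:f:], ι[:f:]⟫ = Σ_sectors ∫ |Φ|²` by `inner_wickVector_wickVector` of the
previous file, each sector integral over a probability measure bounded by the square of the sup bound.
-/

noncomputable section

namespace Summit.AtomisticToContinuum.FouriersLaw.Theorems.DrudeDissolution.GramPencilHarmonicChaos

open MeasureTheory Filter Set Function Topology
open scoped InnerProductSpace ENNReal ComplexConjugate
open Literature.MathematicalPhysics.KineticTheory
open Literature.MathematicalPhysics.KineticTheory.HeatConduction
open HarmonicChaos
open PinnedChainKinetic (𝕋 𝕋3 μ𝕋 μ𝕋3 k₄ sinT dispersion)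
open scoped Literature.MathematicalPhysics.KineticTheory.HeatConduction.PinnedChainKinetic

/-! ## Sup norms of thermal waves and bounds for Wick kernels / Wick vectors -/

/-- The sup norm `⨆_k ‖w_f(k)‖` of a thermal wave is attained-bounded (continuity on the compact circle):
`‖w_f(k)‖ ≤ ⨆_k ‖w_f(k)‖`. [folklore] -/
theorem norm_thermalWave_le_ciSup {ω₂ : ℝ} (hω : 0 < ω₂) (T : ℝ) (f : TestFn) (k : 𝕋) :
    ‖thermalWave ω₂ T f k‖ ≤ ⨆ k, ‖thermalWave ω₂ T f k‖ :=
  le_ciSup (f := fun k => ‖thermalWave ω₂ T f k‖)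
    (isCompact_range (continuous_thermalWave hω T f).norm).bddAbove k

/-- The sup norm of a thermal wave is non-negative. [folklore] -/
theorem ciSup_norm_thermalWave_nonneg (ω₂ T : ℝ) (f : TestFn) :
    0 ≤ ⨆ k, ‖thermalWave ω₂ T f k‖ :=
  Real.iSup_nonneg fun _ => norm_nonneg _

/-- If `L` multiplies thermal waves by `−iω`, it multiplies their sup norms by at most `sup ω ≤ √(|ω₂| + 4)`.
[folklore] -/
theorem ciSup_norm_thermalWave_apply_le {ω₂ : ℝ} (hω : 0 < ω₂) (T : ℝ) {L : TestFn → TestFn}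
    (hL : ∀ (f : TestFn) (k : 𝕋), thermalWave ω₂ T (L f) k =
      -Complex.I * (dispersion ω₂ k : ℂ) * thermalWave ω₂ T f k) (f : TestFn) :
    (⨆ k, ‖thermalWave ω₂ T (L f) k‖) ≤ Real.sqrt (|ω₂| + 4) * ⨆ k, ‖thermalWave ω₂ T f k‖ := by
  refine ciSup_le fun k => ?_
  rw [hL, norm_mul, norm_mul, norm_neg, Complex.norm_I, one_mul, Complex.norm_real, Real.norm_eq_abs,
    abs_of_nonneg (PinnedChainKinetic.dispersion_nonneg ω₂ k)]
  exact mul_le_mul (PinnedChainKinetic.dispersion_le ω₂ k) (norm_thermalWave_le_ciSup hω T f k)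
    (norm_nonneg _) (Real.sqrt_nonneg _)

/-- **The weights of the closed system grow at most linearly under one application of `L`**:
`Σ_i Π_j B((f[i ← L f_i])_j) ≤ N √(|ω₂|+4) Π_j B(f_j)`, `B(f) = ⨆_k ‖w_f(k)‖`. [folklore] -/
theorem sum_prod_ciSup_update_le {ω₂ : ℝ} (hω : 0 < ω₂) (T : ℝ) {L : TestFn → TestFn}
    (hL : ∀ (f : TestFn) (k : 𝕋), thermalWave ω₂ T (L f) k =
      -Complex.I * (dispersion ω₂ k : ℂ) * thermalWave ω₂ T f k) {N : ℕ} (h : Fin N → TestFn) :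
    ∑ i, ∏ j, (⨆ k, ‖thermalWave ω₂ T (Function.update h i (L (h i)) j) k‖) ≤
      (N * Real.sqrt (|ω₂| + 4)) * ∏ j, (⨆ k, ‖thermalWave ω₂ T (h j) k‖) := by
  classical
  have hB : ∀ i, ∏ j, (⨆ k, ‖thermalWave ω₂ T (Function.update h i (L (h i)) j) k‖) ≤
      Real.sqrt (|ω₂| + 4) * ∏ j, (⨆ k, ‖thermalWave ω₂ T (h j) k‖) := by
    intro i
    have h1 : (fun j => ⨆ k, ‖thermalWave ω₂ T (Function.update h i (L (h i)) j) k‖) =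
        Function.update (fun j => ⨆ k, ‖thermalWave ω₂ T (h j) k‖) i
          (⨆ k, ‖thermalWave ω₂ T (L (h i)) k‖) := by
      funext j
      by_cases hj : j = i
      · subst hj; simp
      · rw [Function.update_of_ne hj, Function.update_of_ne hj]
    rw [h1, Finset.prod_update_of_mem (Finset.mem_univ i),
      Finset.prod_eq_mul_prod_sdiff_singleton_of_mem (Finset.mem_univ i)
        (fun j => ⨆ k, ‖thermalWave ω₂ T (h j) k‖), ← mul_assoc]
    refine mul_le_mul_of_nonneg_right (ciSup_norm_thermalWave_apply_le hω T hL (h i)) ?_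
    exact Finset.prod_nonneg fun j _ => ciSup_norm_thermalWave_nonneg ω₂ T (h j)
  calc ∑ i, ∏ j, (⨆ k, ‖thermalWave ω₂ T (Function.update h i (L (h i)) j) k‖)
      ≤ ∑ _i : Fin N, Real.sqrt (|ω₂| + 4) * ∏ j, (⨆ k, ‖thermalWave ω₂ T (h j) k‖) :=
        Finset.sum_le_sum fun i _ => hB i
    _ = (N * Real.sqrt (|ω₂| + 4)) * ∏ j, (⨆ k, ‖thermalWave ω₂ T (h j) k‖) := by
        rw [Finset.sum_const, Finset.card_univ, Fintype.card_fin, nsmul_eq_mul]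
        ring

/-- **Sup bound for Wick kernels**: `‖Φ[f]_{m,n}(κ)‖ ≤ N! Π_i B(f_i)`. [folklore] -/
theorem norm_wickKernel_le {ω₂ : ℝ} (hω : 0 < ω₂) (T : ℝ) {N : ℕ} (h : Fin N → TestFn) (m n : ℕ)
    (κ : Shell m n) :
    ‖wickKernel ω₂ T h m n κ‖ ≤ (N.factorial : ℝ) * ∏ i, (⨆ k, ‖thermalWave ω₂ T (h i) k‖) := by
  classical
  have hP : 0 ≤ ∏ i, (⨆ k, ‖thermalWave ω₂ T (h i) k‖) :=
    Finset.prod_nonneg fun i _ => ciSup_norm_thermalWave_nonneg ω₂ T (h i)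
  unfold wickKernel
  rw [norm_mul]
  -- the normalisation constant has norm `≤ 1`
  have hc : ‖((Real.sqrt (m.factorial * n.factorial) : ℝ) : ℂ)⁻¹‖ ≤ 1 := by
    rw [norm_inv, Complex.norm_real, Real.norm_eq_abs, abs_of_nonneg (Real.sqrt_nonneg _)]
    have h1 : (1 : ℝ) ≤ Real.sqrt (m.factorial * n.factorial) := by
      rw [Real.one_le_sqrt]
      have hm : (1 : ℝ) ≤ m.factorial := by exact_mod_cast m.factorial_pos
      have hn : (1 : ℝ) ≤ n.factorial := by exact_mod_cast n.factorial_pos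
      nlinarith
    exact inv_le_one_of_one_le₀ h1
  -- each assignment contributes at most `Π_i B(f_i)`
  have hβ : ∀ β : (Fin m ⊕ Fin n) ≃ Fin N,
      ‖(∏ i, conj (thermalWave ω₂ T (h (β (Sum.inl i))) ((κ : SectorConfig m n).1 i))) *
          ∏ j, thermalWave ω₂ T (h (β (Sum.inr j))) ((κ : SectorConfig m n).2 j)‖ ≤
        ∏ i, (⨆ k, ‖thermalWave ω₂ T (h i) k‖) := by
    intro β
    rw [norm_mul, norm_prod, norm_prod, ← Equiv.prod_comp β, Fintype.prod_sum_type]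
    refine mul_le_mul ?_ ?_ (Finset.prod_nonneg fun j _ => norm_nonneg _)
      (Finset.prod_nonneg fun i _ => ciSup_norm_thermalWave_nonneg ω₂ T _)
    · refine Finset.prod_le_prod (fun i _ => norm_nonneg _) fun i _ => ?_
      rw [Complex.norm_conj]
      exact norm_thermalWave_le_ciSup hω T _ _
    · exact Finset.prod_le_prod (fun j _ => norm_nonneg _) fun j _ =>
        norm_thermalWave_le_ciSup hω T _ _
  have hsum : ‖∑ β : (Fin m ⊕ Fin n) ≃ Fin N,
      (∏ i, conj (thermalWave ω₂ T (h (β (Sum.inl i))) ((κ : SectorConfig m n).1 i))) *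
        ∏ j, thermalWave ω₂ T (h (β (Sum.inr j))) ((κ : SectorConfig m n).2 j)‖ ≤
      (N.factorial : ℝ) * ∏ i, (⨆ k, ‖thermalWave ω₂ T (h i) k‖) := by
    refine (norm_sum_le _ _).trans ?_
    refine (Finset.sum_le_sum fun β _ => hβ β).trans ?_
    rw [Finset.sum_const, Finset.card_univ, nsmul_eq_mul]
    refine mul_le_mul_of_nonneg_right ?_ hP
    by_cases hE : IsEmpty ((Fin m ⊕ Fin n) ≃ Fin N)
    · rw [Fintype.card_eq_zero]
      exact_mod_cast Nat.zero_le _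
    · rw [not_isEmpty_iff] at hE
      obtain ⟨β₀⟩ := hE
      rw [Fintype.card_equiv β₀]
      have hcard : Fintype.card (Fin m ⊕ Fin n) = N := by
        simpa using Fintype.card_congr β₀
      rw [hcard]
  calc ‖((Real.sqrt (m.factorial * n.factorial) : ℝ) : ℂ)⁻¹‖ * _ ≤ 1 * ((N.factorial : ℝ) *
        ∏ i, (⨆ k, ‖thermalWave ω₂ T (h i) k‖)) :=
        mul_le_mul hc hsum (norm_nonneg _) zero_le_one
    _ = _ := one_mul _

/-- **Norm bound for Wick vectors**: `‖ι[:f:]‖ ≤ #{sectors of degree N} · N! · Π_i B(f_i)`. [folklore] -/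
theorem norm_wickVector_le {ω₂ : ℝ} (hω : 0 < ω₂) (T : ℝ) {N : ℕ} (h : Fin N → TestFn) :
    ‖wickVector ω₂ T h‖ ≤ (((finite_sectorIndex_sum N).toFinset.card : ℝ) * N.factorial) *
      ∏ i, (⨆ k, ‖thermalWave ω₂ T (h i) k‖) := by
  set X : ℝ := (N.factorial : ℝ) * ∏ i, (⨆ k, ‖thermalWave ω₂ T (h i) k‖) with hX
  have hX0 : 0 ≤ X := mul_nonneg (Nat.cast_nonneg _)
    (Finset.prod_nonneg fun i _ => ciSup_norm_thermalWave_nonneg ω₂ T (h i))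
  set c : ℕ := (finite_sectorIndex_sum N).toFinset.card with hc
  -- `‖v‖² ≤ c X²`
  have hsq : ‖wickVector ω₂ T h‖ ^ 2 ≤ c * X ^ 2 := by
    rw [← inner_self_eq_norm_sq (𝕜 := ℂ), inner_wickVector_wickVector hω T h h]
    change (∑ s ∈ (finite_sectorIndex_sum N).toFinset, _ : ℂ).re ≤ _
    rw [Complex.re_sum]
    have hterm : ∀ s ∈ (finite_sectorIndex_sum N).toFinset,
        (∫ κ, conj (wickKernel ω₂ T h s.cr s.an κ) * wickKernel ω₂ T h s.cr s.an κ
          ∂(shellMeasure s.cr s.an)).re ≤ X ^ 2 := by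
      intro s _
      refine (Complex.re_le_norm _).trans ?_
      have hb := norm_integral_le_of_norm_le_const (μ := shellMeasure s.cr s.an)
        (f := fun κ => conj (wickKernel ω₂ T h s.cr s.an κ) * wickKernel ω₂ T h s.cr s.an κ)
        (C := X ^ 2) (ae_of_all _ fun κ => ?_)
      · simpa using hb
      · rw [norm_mul, Complex.norm_conj, ← sq]
        exact pow_le_pow_left₀ (norm_nonneg _) (norm_wickKernel_le hω T h s.cr s.an κ) 2
    refine (Finset.sum_le_sum hterm).trans ?_
    rw [Finset.sum_const, nsmul_eq_mul]
  -- hence `‖v‖ ≤ c X`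
  have hc1 : (c : ℝ) * X ^ 2 ≤ ((c : ℝ) * X) ^ 2 := by
    have hcc : (c : ℝ) ≤ (c : ℝ) ^ 2 := by
      rcases Nat.eq_zero_or_pos c with h0 | hpos
      · simp [h0]
      · have h1 : (1 : ℝ) ≤ c := by exact_mod_cast hpos
        nlinarith
    calc (c : ℝ) * X ^ 2 ≤ (c : ℝ) ^ 2 * X ^ 2 := mul_le_mul_of_nonneg_right hcc (sq_nonneg X)
      _ = ((c : ℝ) * X) ^ 2 := by ring
  have h2 : ‖wickVector ω₂ T h‖ ^ 2 ≤ ((c : ℝ) * X) ^ 2 := hsq.trans hc1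
  have h3 := (pow_le_pow_iff_left₀ (norm_nonneg _) (mul_nonneg (Nat.cast_nonneg _) hX0)
    two_ne_zero).1 h2
  simpa [hX, mul_assoc] using h3




/-- **Norm bound for Wick vectors** (closed `∀`-form registered for this helper file):
`‖ι[:f:]‖ ≤ #{sectors of degree N} · N! · Π_i ⨆_k ‖w_{f_i}(k)‖`. [folklore] -/
theorem wickVector_norm_le :
    ∀ (ω₂ T : ℝ), 0 < ω₂ → ∀ (N : ℕ) (h : Fin N → TestFn),
      ‖wickVector ω₂ T h‖ ≤ (((finite_sectorIndex_sum N).toFinset.card : ℝ) * N.factorial) *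
        ∏ i : Fin N, (⨆ k : 𝕋, ‖thermalWave ω₂ T (h i) k‖) :=
  fun _ T hω _ h => norm_wickVector_le hω T h

end Summit.AtomisticToContinuum.FouriersLaw.Theorems.DrudeDissolution.GramPencilHarmonicChaos

end
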